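import Literature.Analysis.Distribution.EllipticRegularity
import HarnessLib

/-!
# Interior regularity of distributional solutions of divergence-form elliptic equations with
# smooth coefficients, from Folland's Cor. (6.34)

Topic `Analysis/Distribution`; a consumer-side wrapper of the named fact
`Literature.Analysis.Distribution.Folland1995_cor634` (Folland, *Introduction to Partial
Differential Equations*, 2nd ed. (1995), Cor. (6.34): "Every elliptic operator with `C^∞`
coefficients is hypoelliptic") for the operators that arise as coordinate expressions of
`√g (Δ_h − f)` on a Riemannian manifold: **second-order operators in divergence form**
`L u = ∑ᵢⱼ ∂ⱼ(aᵢⱼ ∂ᵢ u) − c u` with smooth coefficients and positive definite `(aᵢⱼ)`.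

* `divFormWords κ`, `divFormCoeff b a c` — the presentation of
  `P = ∑ᵢⱼ aᵢⱼ ∂ᵢ∂ⱼ + ∑ⱼ (∑ᵢ ∂ᵢaᵢⱼ) ∂ⱼ − c` by words of length `≤ 2` in the constant coordinate
  fields `bₖ` of a basis `b` (the format of `EllipticRegularity.lean`: `smoothDiffOp`,
  `principalSymbol`, `IsEllipticOn`);
* `principalSymbol_divForm` — its principal symbol is `σ₂(x, ξ) = ∑ᵢⱼ aᵢⱼ(x) ξ(bᵢ) ξ(bⱼ)`, so
  `isEllipticOn_divForm`: positive definiteness of `(aᵢⱼ(x))` on `s` gives ellipticity of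
  order `2` on `s`;
* `smoothDiffOpTranspose_divForm` — **its formal transpose is the divergence-form operator**:
  `ᵗP φ = ∑ᵢⱼ ∂ⱼ(aᵢⱼ ∂ᵢφ) − c φ` (`ᵗ∂ₖ = −∂ₖ` for constant fields, and
  `∂ⱼ∂ᵢ(aᵢⱼφ) − ∂ⱼ((∂ᵢaᵢⱼ)φ) = ∂ⱼ(aᵢⱼ ∂ᵢφ)`; no symmetry of `a` is needed);
* `exists_contDiffOn_ae_eq_of_divForm_weak` — **interior regularity**: granted
  `Folland1995_cor634`, if `u ∈ L¹_loc(Ω)` satisfies `∫ u (∑ᵢⱼ ∂ⱼ(aᵢⱼ ∂ᵢφ) − c φ) dμ = ∫ G φ dμ`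
  for all smooth `φ` compactly supported in the open set `Ω`, with `aᵢⱼ, c, G ∈ C^∞(Ω)` and
  `(aᵢⱼ)` positive definite on `Ω`, then every point of `Ω` has an open neighbourhood `U ⊆ Ω`
  on which `u` agrees a.e. with a `C^∞(U)` function. (Cut the coefficients off to all of `E`
  without changing them on a small ball `U`, apply (6.34) to the distribution `u dμ` on `U`,
  whose image under `P` is `G` by the transpose identity, and identify `u` with the smooth
  representative by the fundamental lemma of the calculus of variations, Mathlib's
  `IsOpen.ae_eq_zero_of_integral_contDiff_smul_eq_zero`.)

This is the regularity step of Schoen–Yau's Lemma 3.2 (Comm. Math. Phys. 65 (1979), p. 65: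
the solutions of (3.4) are "smooth" by "standard linear elliptic theory [18, p. 262]") in the
form needed to upgrade the energy-space solution of `AFLinearWeakExistence.lean` to a classical
one, chart by chart. All results are proved (two auxiliary definitions with unfolding lemmas, no
named facts); the elliptic regularity theorem itself enters only as the hypothesis
`(hF : Folland1995_cor634)`.

## References

* G. B. Folland, *Introduction to Partial Differential Equations*, 2nd ed., Princeton University
  Press 1995, Thm. (6.33), Cor. (6.34). [Folland2020]
* R. Schoen, S.-T. Yau, *On the proof of the positive mass conjecture in general relativity*,
  Comm. Math. Phys. 65 (1979) 45–76, proof of Lemma 3.2 (p. 65). [SchoenYauPMT1979]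
* C. B. Morrey, *Multiple Integrals in the Calculus of Variations*, Springer 1966, Thm. 6.2.5
  (interior regularity for elliptic systems with smooth coefficients).
-/

noncomputable section

open MeasureTheory TopologicalSpace Set Function Filter Distributions Metric
open scoped ContDiff Topology

namespace Literature.Analysis.Distribution

variable {E : Type*} [NormedAddCommGroup E] [NormedSpace ℝ E]

/-! ### Constant vector fields: `ᵗ(∂_v) = −∂_v` -/

section ConstField

/-- The divergence of a constant vector field vanishes. [folklore] -/
theorem fieldDiv_const (v : E) (x : E) : fieldDiv (fun _ : E ↦ v) x = 0 := by
  simp [fieldDiv]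

/-- The formal transpose of the directional derivative along a constant field is its negative:
`ᵗ(∂_v) g = −∂_v g`. [folklore] -/
theorem fieldTranspose_const (v : E) (g : E → ℝ) (x : E) :
    fieldTranspose (fun _ : E ↦ v) g x = -fderiv ℝ g x v := by
  simp [fieldTranspose, fieldDiv_const, fieldDeriv]

/-- `ᵗ(∂_v)` along a constant field, as a function. [folklore] -/
theorem fieldTranspose_const_eq (v : E) (g : E → ℝ) :
    fieldTranspose (fun _ : E ↦ v) g = fun x ↦ -fderiv ℝ g x v :=
  funext (fieldTranspose_const v g)

end ConstField

/-! ### The divergence-form presentation and its formal transpose -/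

section Presentation

variable {κ : Type*} [Fintype κ] [DecidableEq κ] (b : Module.Basis κ ℝ E)

/-- The words of the presentation: `[i, j]` (second order), `[j]` (first order), `[]`. [folklore] -/
def divFormWords (κ : Type*) [Fintype κ] [DecidableEq κ] : Finset (List κ) :=
  (Finset.univ.image fun p : κ × κ ↦ [p.1, p.2]) ∪ (Finset.univ.image fun j : κ ↦ [j]) ∪ {[]}

/-- The coefficients of the presentation `P = ∑ᵢⱼ aᵢⱼ ∂ᵢ∂ⱼ + ∑ⱼ (∑ᵢ ∂ᵢaᵢⱼ) ∂ⱼ − c`: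
`a_{[i,j]} = aᵢⱼ`, `a_{[j]} = ∑ᵢ ∂ᵢ aᵢⱼ`, `a_{[]} = −c`. [folklore] -/
def divFormCoeff (a : κ → κ → E → ℝ) (c : E → ℝ) : List κ → E → ℝ
  | [] => fun x ↦ -c x
  | [j] => fun x ↦ ∑ i, fderiv ℝ (a i j) x (b i)
  | [i, j] => a i j
  | _ :: _ :: _ :: _ => 0

omit [DecidableEq κ] in
/-- The zeroth-order coefficient is `−c`. [folklore] -/
@[simp] theorem divFormCoeff_nil (a : κ → κ → E → ℝ) (c : E → ℝ) :
    divFormCoeff b a c [] = fun x ↦ -c x := rfl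

omit [DecidableEq κ] in
/-- The first-order coefficients are `∑ᵢ ∂ᵢ aᵢⱼ`. [folklore] -/
@[simp] theorem divFormCoeff_single (a : κ → κ → E → ℝ) (c : E → ℝ) (j : κ) :
    divFormCoeff b a c [j] = fun x ↦ ∑ i, fderiv ℝ (a i j) x (b i) := rfl

omit [DecidableEq κ] in
/-- The second-order coefficients are `aᵢⱼ`. [folklore] -/
@[simp] theorem divFormCoeff_pair (a : κ → κ → E → ℝ) (c : E → ℝ) (i j : κ) :
    divFormCoeff b a c [i, j] = a i j := rfl

/-- Decomposition of a sum over the words of the presentation. [folklore] -/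
theorem sum_divFormWords (F : List κ → ℝ) :
    ∑ w ∈ divFormWords κ, F w = (∑ i, ∑ j, F [i, j]) + (∑ j, F [j]) + F [] := by
  unfold divFormWords
  have hd1 : Disjoint (Finset.univ.image fun p : κ × κ ↦ [p.1, p.2])
      (Finset.univ.image fun j : κ ↦ [j]) := by
    rw [Finset.disjoint_left]
    intro w hw hw'
    obtain ⟨p, -, rfl⟩ := Finset.mem_image.1 hw
    obtain ⟨j, -, hj⟩ := Finset.mem_image.1 hw'
    simpa using congr_arg List.length hj
  have hd2 : Disjoint ((Finset.univ.image fun p : κ × κ ↦ [p.1, p.2]) ∪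
      (Finset.univ.image fun j : κ ↦ [j])) {[]} := by
    rw [Finset.disjoint_singleton_right, Finset.mem_union, not_or]
    constructor
    · intro h
      obtain ⟨p, -, hp⟩ := Finset.mem_image.1 h
      simpa using congr_arg List.length hp
    · intro h
      obtain ⟨j, -, hj⟩ := Finset.mem_image.1 h
      simpa using congr_arg List.length hj
  rw [Finset.sum_union hd2, Finset.sum_union hd1, Finset.sum_singleton,
    Finset.sum_image (fun p _ q _ h ↦ by
      obtain ⟨p1, p2⟩ := p
      obtain ⟨q1, q2⟩ := q
      simp only [List.cons.injEq, and_true] at h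
      rw [h.1, h.2]),
    Finset.sum_image (fun i _ j _ h ↦ by simpa using h),
    ← Finset.univ_product_univ, Finset.sum_product]

/-- The words of the presentation have length `≤ 2`. [folklore] -/
theorem length_le_two_of_mem_divFormWords {w : List κ} (hw : w ∈ divFormWords κ) :
    w.length ≤ 2 := by
  unfold divFormWords at hw
  rcases Finset.mem_union.1 hw with hw | hw
  · rcases Finset.mem_union.1 hw with hw | hw
    · obtain ⟨p, -, rfl⟩ := Finset.mem_image.1 hw; simp
    · obtain ⟨j, -, rfl⟩ := Finset.mem_image.1 hw; simp
  · rw [Finset.mem_singleton] at hw; rw [hw]; simp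

/-- The coefficients of the presentation are smooth for smooth `a`, `c`. [folklore] -/
theorem contDiff_divFormCoeff {a : κ → κ → E → ℝ} {c : E → ℝ} (ha : ∀ i j, ContDiff ℝ ∞ (a i j))
    (hc : ContDiff ℝ ∞ c) : ∀ w ∈ divFormWords κ, ContDiff ℝ ∞ (divFormCoeff b a c w) := by
  intro w hw
  unfold divFormWords at hw
  rcases Finset.mem_union.1 hw with hw | hw
  · rcases Finset.mem_union.1 hw with hw | hw
    · obtain ⟨p, -, rfl⟩ := Finset.mem_image.1 hw
      exact ha p.1 p.2
    · obtain ⟨j, -, rfl⟩ := Finset.mem_image.1 hw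
      rw [divFormCoeff_single]
      exact ContDiff.sum fun i _ ↦
        ((ha i j).fderiv_right (m := ∞) (by exact_mod_cast le_top)).clm_apply contDiff_const
  · rw [Finset.mem_singleton] at hw
    rw [hw, divFormCoeff_nil]
    exact hc.neg

/-- **The principal symbol of the presentation is the quadratic form of `a`**:
`σ₂(x, ξ) = ∑ᵢⱼ aᵢⱼ(x) ξ(bᵢ) ξ(bⱼ)`. [folklore] -/
theorem principalSymbol_divForm (a : κ → κ → E → ℝ) (c : E → ℝ) (x : E) (ξ : E →L[ℝ] ℝ) :
    principalSymbol (fun k : κ ↦ fun _ : E ↦ b k) (divFormWords κ) (divFormCoeff b a c) 2 x ξ =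
      ∑ i, ∑ j, a i j x * (ξ (b i) * ξ (b j)) := by
  unfold principalSymbol
  have hfilter : (divFormWords κ).filter (fun w : List κ ↦ w.length = 2) =
      Finset.univ.image fun p : κ × κ ↦ [p.1, p.2] := by
    ext w
    simp only [Finset.mem_filter, divFormWords, Finset.mem_union, Finset.mem_image,
      Finset.mem_univ, true_and, Finset.mem_singleton]
    constructor
    · rintro ⟨h | h, hl⟩
      · rcases h with h | ⟨j, rfl⟩
        · exact h
        · simp at hl
      · rw [h] at hl; simp at hl
    · rintro ⟨p, rfl⟩
      exact ⟨Or.inl (Or.inl ⟨p, rfl⟩), by simp⟩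
  rw [hfilter, Finset.sum_image (fun p _ q _ h ↦ by
      obtain ⟨p1, p2⟩ := p
      obtain ⟨q1, q2⟩ := q
      simp only [List.cons.injEq, and_true] at h
      rw [h.1, h.2]),
    ← Finset.univ_product_univ, Finset.sum_product]
  refine Finset.sum_congr rfl fun i _ ↦ Finset.sum_congr rfl fun j _ ↦ ?_
  simp

/-- **Ellipticity**: if the quadratic form `v ↦ ∑ᵢⱼ aᵢⱼ(x) vᵢ vⱼ` is positive definite at
every point of `s`, the presentation is elliptic of order `2` on `s`. [folklore] -/
theorem isEllipticOn_divForm {a : κ → κ → E → ℝ} (c : E → ℝ) {s : Set E}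
    (hpos : ∀ x ∈ s, ∀ v : κ → ℝ, v ≠ 0 → 0 < ∑ i, ∑ j, a i j x * (v i * v j)) :
    IsEllipticOn (fun k : κ ↦ fun _ : E ↦ b k) (divFormWords κ) (divFormCoeff b a c) 2 s := by
  refine ⟨fun w hw ↦ length_le_two_of_mem_divFormWords hw, fun x hx ξ hξ hzero ↦ hξ ?_⟩
  rw [principalSymbol_divForm] at hzero
  have hv : (fun i ↦ ξ (b i)) = 0 := by
    by_contra hv
    exact (hpos x hx _ hv).ne' hzero
  refine ContinuousLinearMap.ext fun v ↦ ?_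
  have hi : ∀ i, ξ (b i) = 0 := fun i ↦ congr_fun hv i
  rw [← b.sum_repr v, map_sum]
  simp [hi]

/-- **The formal transpose of the presentation is the divergence-form operator**: for smooth
`a`, `c`, `φ`,
`ᵗP φ = ∑ᵢⱼ ∂ⱼ(aᵢⱼ ∂ᵢφ) − c φ`, where `P = ∑ᵢⱼ aᵢⱼ ∂ᵢ∂ⱼ + ∑ⱼ (∑ᵢ ∂ᵢaᵢⱼ) ∂ⱼ − c` is presented by
words in the constant coordinate fields `bₖ` (`ᵗ∂ₖ = −∂ₖ`, and
`∂ⱼ∂ᵢ(aᵢⱼ φ) − ∂ⱼ((∂ᵢaᵢⱼ) φ) = ∂ⱼ(aᵢⱼ ∂ᵢφ)` by the Leibniz rule). [folklore] -/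
theorem smoothDiffOpTranspose_divForm {a : κ → κ → E → ℝ} {c : E → ℝ}
    (ha : ∀ i j, ContDiff ℝ ∞ (a i j)) {φ : E → ℝ} (hφ : ContDiff ℝ ∞ φ) (x : E) :
    smoothDiffOpTranspose (fun k : κ ↦ fun _ : E ↦ b k) (divFormWords κ) (divFormCoeff b a c) φ x =
      (∑ i, ∑ j, fderiv ℝ (fun y ↦ a i j y * fderiv ℝ φ y (b i)) x (b j)) - c x * φ x := by
  have h1 : ContDiff ℝ 1 φ := hφ.of_le (by exact_mod_cast le_top)
  have hdφ : ∀ i, ContDiff ℝ ∞ (fun y ↦ fderiv ℝ φ y (b i)) := fun i ↦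
    (hφ.fderiv_right (m := ∞) (by exact_mod_cast le_top)).clm_apply contDiff_const
  have hda : ∀ i j k, ContDiff ℝ ∞ (fun y ↦ fderiv ℝ (a i j) y (b k)) := fun i j k ↦
    ((ha i j).fderiv_right (m := ∞) (by exact_mod_cast le_top)).clm_apply contDiff_const
  unfold smoothDiffOpTranspose
  rw [sum_divFormWords]
  simp only [wordTranspose_cons, wordTranspose_nil, fieldTranspose_const_eq, divFormCoeff_pair,
    divFormCoeff_single, divFormCoeff_nil, fderiv_fun_neg, neg_apply, neg_neg]
  -- the zeroth-order term
  have h0 : -c x * φ x = -(c x * φ x) := by ring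
  rw [h0, ← sub_eq_add_neg]
  congr 1
  -- `∑ᵢⱼ ∂ⱼ∂ᵢ(aᵢⱼ φ) − ∑ⱼ ∂ⱼ((∑ᵢ ∂ᵢaᵢⱼ) φ) = ∑ᵢⱼ ∂ⱼ(aᵢⱼ ∂ᵢφ)`
  have hprod : ∀ i j, (fun y ↦ fderiv ℝ (fun z ↦ a i j z * φ z) y (b i)) =
      fun y ↦ fderiv ℝ (a i j) y (b i) * φ y + a i j y * fderiv ℝ φ y (b i) := by
    intro i j
    funext y
    rw [fderiv_fun_mul ((ha i j).differentiable (by simp) y) (h1.differentiable (by simp) y)]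
    simp only [add_apply, smul_apply, smul_eq_mul]
    ring
  have hdiff1 : ∀ i j, Differentiable ℝ (fun y ↦ fderiv ℝ (a i j) y (b i) * φ y) :=
    fun i j ↦ ((hda i j i).mul hφ).differentiable (by simp)
  have hdiff2 : ∀ i j, Differentiable ℝ (fun y ↦ a i j y * fderiv ℝ φ y (b i)) :=
    fun i j ↦ ((ha i j).mul (hdφ i)).differentiable (by simp)
  -- the first-order term: `∂ⱼ((∑ᵢ ∂ᵢaᵢⱼ) φ) = ∑ᵢ ∂ⱼ((∂ᵢaᵢⱼ) φ)`
  have hfirst : ∀ j, fderiv ℝ (fun y ↦ (∑ i, fderiv ℝ (a i j) y (b i)) * φ y) x (b j) =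
      ∑ i, fderiv ℝ (fun y ↦ fderiv ℝ (a i j) y (b i) * φ y) x (b j) := by
    intro j
    have : (fun y ↦ (∑ i, fderiv ℝ (a i j) y (b i)) * φ y) =
        fun y ↦ ∑ i, fderiv ℝ (a i j) y (b i) * φ y := by
      funext y; rw [Finset.sum_mul]
    rw [this, fderiv_fun_sum fun i _ ↦ (hdiff1 i j x)]
    simp only [FunLike.coe_sum, Finset.sum_apply]
  -- the second-order term splits by the Leibniz rule
  have hT : ∀ i j, fderiv ℝ (fun y ↦ fderiv ℝ (a i j) y (b i) * φ y + a i j y * fderiv ℝ φ y (b i))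
        x (b j) =
      fderiv ℝ (fun y ↦ fderiv ℝ (a i j) y (b i) * φ y) x (b j) +
        fderiv ℝ (fun y ↦ a i j y * fderiv ℝ φ y (b i)) x (b j) := by
    intro i j
    rw [fderiv_fun_add (hdiff1 i j x) (hdiff2 i j x)]
    rfl
  simp only [hfirst, hprod, hT, Finset.sum_add_distrib, Finset.sum_neg_distrib]
  have hc : ∑ j, ∑ i, fderiv ℝ (fun y ↦ fderiv ℝ (a i j) y (b i) * φ y) x (b j) =
      ∑ i, ∑ j, fderiv ℝ (fun y ↦ fderiv ℝ (a i j) y (b i) * φ y) x (b j) := Finset.sum_comm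
  rw [hc]
  ring

end Presentation



/-! ### Interior regularity from Folland's Cor. (6.34) -/

section Regularity

variable {E : Type} [NormedAddCommGroup E] [NormedSpace ℝ E] [FiniteDimensional ℝ E]
  [MeasurableSpace E] [BorelSpace E] (μ : Measure E) [μ.IsAddHaarMeasure]
  {κ : Type} [Fintype κ] [DecidableEq κ] (b : Module.Basis κ ℝ E)

omit [FiniteDimensional ℝ E] [MeasurableSpace E] [BorelSpace E] in
/-- A smooth cut-off times a function smooth on an open set containing the support of the
cut-off is smooth everywhere. [folklore] -/
theorem contDiff_mul_of_tsupport_subset {χ g : E → ℝ} {U : Set E} (hU : IsOpen U)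
    (hχ : ContDiff ℝ ∞ χ) (hχU : tsupport χ ⊆ U) (hg : ContDiffOn ℝ ∞ g U) :
    ContDiff ℝ ∞ fun x ↦ χ x * g x := by
  refine contDiff_iff_contDiffAt.2 fun x ↦ ?_
  by_cases hx : x ∈ U
  · exact hχ.contDiffAt.mul (hg.contDiffAt (hU.mem_nhds hx))
  · have hx' : x ∉ tsupport χ := fun h ↦ hx (hχU h)
    have hev : χ =ᶠ[𝓝 x] 0 := notMem_tsupport_iff_eventuallyEq.1 hx'
    have hev' : (fun y ↦ χ y * g y) =ᶠ[𝓝 x] fun _ ↦ 0 := by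
      filter_upwards [hev] with y hy
      rw [hy, Pi.zero_apply, zero_mul]
    exact (contDiffAt_const (c := (0 : ℝ))).congr_of_eventuallyEq hev'

omit [FiniteDimensional ℝ E] [MeasurableSpace E] [BorelSpace E] in
/-- The derivative of a function vanishes off its topological support. [folklore] -/
theorem fderiv_apply_eq_zero_of_notMem_tsupport {φ : E → ℝ} {x : E} (hx : x ∉ tsupport φ)
    (v : E) : fderiv ℝ φ x v = 0 := by
  have : x ∉ tsupport (fderiv ℝ φ) := fun h ↦ hx (tsupport_fderiv_subset ℝ h)
  rw [image_eq_zero_of_notMem_tsupport this, zero_apply]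

/-- **Interior regularity for divergence-form elliptic equations with smooth coefficients, from
Folland's Cor. (6.34).** Let `Ω ⊆ E` be open (`E ≅ ℝⁿ` with a basis `b` and a Haar measure
`μ`), `aᵢⱼ, c, G` smooth on `Ω` with `(aᵢⱼ(x))` positive definite for `x ∈ Ω`, and
`u ∈ L¹_loc(Ω)` a distributional solution of `∑ᵢⱼ ∂ⱼ(aᵢⱼ ∂ᵢu) − c u = G`, i.e.
`∫ u (∑ᵢⱼ ∂ⱼ(aᵢⱼ ∂ᵢφ) − c φ) dμ = ∫ G φ dμ` for all smooth `φ` compactly supported in `Ω`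
(`∂ₖ` the derivative along `bₖ`). Then `u` is smooth near every point of `Ω`: each `x₀ ∈ Ω`
has an open neighbourhood `U ⊆ Ω` and `w ∈ C^∞(U)` with `u = w` a.e. on `U`.
*Proof.* Granted the named fact `Folland1995_cor634` ((6.34): elliptic operators with smooth
coefficients are hypoelliptic): on a small ball `U` around `x₀` the operator, with coefficients
cut off to be smooth on all of `E` (`aᵢⱼ ↦ χ aᵢⱼ + (1 − χ) δᵢⱼ`, unchanged on `U`), is
presented by words in the constant fields `bₖ` (`divFormWords`, `divFormCoeff`), is elliptic
of order `2` on `U` (`isEllipticOn_divForm`), and its formal transpose is the divergence-form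
operator of the hypothesis (`smoothDiffOpTranspose_divForm`); so the distribution `u dμ` on
`U` has smooth image, hence is smooth (`IsSmoothOn`), and the fundamental lemma of the calculus
of variations (`IsOpen.ae_eq_zero_of_integral_contDiff_smul_eq_zero`) identifies `u` with the
smooth representative a.e. [cite: Folland2020, Cor. (6.34)] -/
theorem exists_contDiffOn_ae_eq_of_divForm_weak [Nontrivial E] (hF : Folland1995_cor634)
    {Ω : Set E} (hΩ : IsOpen Ω)
    {a : κ → κ → E → ℝ} (ha : ∀ i j, ContDiffOn ℝ ∞ (a i j) Ω)
    (hpos : ∀ x ∈ Ω, ∀ v : κ → ℝ, v ≠ 0 → 0 < ∑ i, ∑ j, a i j x * (v i * v j))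
    {c : E → ℝ} (hc : ContDiffOn ℝ ∞ c Ω) {G : E → ℝ} (hG : ContDiffOn ℝ ∞ G Ω)
    {u : E → ℝ} (hu : LocallyIntegrableOn u Ω μ)
    (hweak : ∀ φ : E → ℝ, ContDiff ℝ ∞ φ → HasCompactSupport φ → tsupport φ ⊆ Ω →
      ∫ x, u x * ((∑ i, ∑ j, fderiv ℝ (fun y ↦ a i j y * fderiv ℝ φ y (b i)) x (b j)) -
        c x * φ x) ∂μ = ∫ x, G x * φ x ∂μ)
    {x₀ : E} (hx₀ : x₀ ∈ Ω) :
    ∃ U : Set E, IsOpen U ∧ x₀ ∈ U ∧ U ⊆ Ω ∧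
      ∃ w : E → ℝ, ContDiffOn ℝ ∞ w U ∧ ∀ᵐ x ∂μ, x ∈ U → u x = w x := by
  classical
  -- a ball around `x₀` and a cut-off equal to `1` on it
  obtain ⟨ε, hε, hball⟩ := Metric.isOpen_iff.1 hΩ x₀ hx₀
  let χ : ContDiffBump x₀ := ⟨ε / 4, ε / 2, by positivity, by linarith⟩
  have hχ1 : ∀ x ∈ closedBall x₀ (ε / 4), χ x = 1 := fun x hx ↦ χ.one_of_mem_closedBall hx
  have hχΩ : tsupport (χ : E → ℝ) ⊆ Ω := by
    rw [χ.tsupport_eq]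
    exact (closedBall_subset_ball (by show ε / 2 < ε; linarith)).trans hball
  have hχs : ContDiff ℝ ∞ (χ : E → ℝ) := χ.contDiff
  obtain ⟨U, hU⟩ : ∃ U : Set E, U = ball x₀ (ε / 4) := ⟨_, rfl⟩
  have hUo : IsOpen U := by rw [hU]; exact isOpen_ball
  have hUcb : U ⊆ closedBall x₀ (ε / 4) := by rw [hU]; exact ball_subset_closedBall
  have hUΩ : U ⊆ Ω := by
    rw [hU]; exact (ball_subset_ball (by linarith)).trans hball
  have hx₀U : x₀ ∈ U := by rw [hU]; exact mem_ball_self (by positivity)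
  -- extended coefficients, smooth on `E` and unchanged on `closedBall x₀ (ε/4) ⊇ U`
  obtain ⟨ae, hae⟩ : ∃ ae : κ → κ → E → ℝ,
      ∀ i j x, ae i j x = χ x * a i j x + (1 - χ x) * (if i = j then 1 else 0) :=
    ⟨fun i j x ↦ χ x * a i j x + (1 - χ x) * (if i = j then 1 else 0), fun _ _ _ ↦ rfl⟩
  obtain ⟨ce, hce⟩ : ∃ ce : E → ℝ, ∀ x, ce x = χ x * c x := ⟨fun x ↦ χ x * c x, fun _ ↦ rfl⟩
  have hae_s : ∀ i j, ContDiff ℝ ∞ (ae i j) := by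
    intro i j
    have h1 := contDiff_mul_of_tsupport_subset hΩ hχs hχΩ (ha i j)
    have h2 : ContDiff ℝ ∞ fun x ↦ (1 - χ x) * (if i = j then (1 : ℝ) else 0) :=
      (contDiff_const.sub hχs).mul contDiff_const
    have : ae i j = fun x ↦ χ x * a i j x + (1 - χ x) * (if i = j then 1 else 0) :=
      funext (hae i j)
    rw [this]
    exact h1.add h2
  have hce_s : ContDiff ℝ ∞ ce := by
    have : ce = fun x ↦ χ x * c x := funext hce
    rw [this]
    exact contDiff_mul_of_tsupport_subset hΩ hχs hχΩ hc
  have hae_eq : ∀ i j, ∀ x ∈ closedBall x₀ (ε / 4), ae i j x = a i j x := by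
    intro i j x hx
    rw [hae, hχ1 x hx]; ring
  have hce_eq : ∀ x ∈ closedBall x₀ (ε / 4), ce x = c x := by
    intro x hx
    rw [hce, hχ1 x hx, one_mul]
  -- the presentation is elliptic on `U`
  have hell : IsEllipticOn (fun k : κ ↦ fun _ : E ↦ b k) (divFormWords κ) (divFormCoeff b ae ce)
      2 U := by
    refine isEllipticOn_divForm b ce fun x hx v hv ↦ ?_
    have h := hpos x (hUΩ hx) v hv
    simpa only [hae_eq _ _ x (hUcb hx)] using h
  -- Folland: the operator is hypoelliptic on `U`
  let UO : Opens E := ⟨U, hUo⟩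
  have hhyp : IsHypoellipticOn UO (smoothDiffOpTranspose (fun k : κ ↦ fun _ : E ↦ b k)
      (divFormWords κ) (divFormCoeff b ae ce)) μ :=
    hF E μ κ UO (fun k : κ ↦ fun _ : E ↦ b k) (divFormWords κ) (divFormCoeff b ae ce) 2
      (fun _ ↦ contDiff_const) (contDiff_divFormCoeff b hae_s hce_s) hell
  -- the distribution `u dμ` on `U`
  have huU : LocallyIntegrableOn u U μ := hu.mono_set hUΩ
  let uD : 𝓓'(UO, ℝ) :=
    (TestFunction.integralAgainstBilinCLM (ContinuousLinearMap.mul ℝ ℝ) μ u : 𝓓(UO, ℝ) →L[ℝ] ℝ)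
  have huD : ∀ φ : 𝓓(UO, ℝ), uD φ = ∫ x, φ x * u x ∂μ := by
    intro φ
    change TestFunction.integralAgainstBilinCLM (ContinuousLinearMap.mul ℝ ℝ) μ u φ = _
    rw [TestFunction.integralAgainstBilinCLM_eq_integral huU]
    simp
  -- the transposed operator acts on test functions supported in `U` as the given operator
  have hLe : ∀ φ : E → ℝ, ContDiff ℝ ∞ φ → tsupport φ ⊆ U → ∀ x,
      smoothDiffOpTranspose (fun k : κ ↦ fun _ : E ↦ b k) (divFormWords κ) (divFormCoeff b ae ce)
        φ x = (∑ i, ∑ j, fderiv ℝ (fun y ↦ a i j y * fderiv ℝ φ y (b i)) x (b j)) -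
          c x * φ x := by
    intro φ hφ hφU x
    rw [smoothDiffOpTranspose_divForm b hae_s hφ]
    have hfun : ∀ i j, (fun y ↦ ae i j y * fderiv ℝ φ y (b i)) =
        fun y ↦ a i j y * fderiv ℝ φ y (b i) := by
      intro i j
      funext y
      by_cases hy : y ∈ closedBall x₀ (ε / 4)
      · rw [hae_eq i j y hy]
      · have hy' : y ∉ tsupport φ := fun h ↦ hy (hUcb (hφU h))
        rw [fderiv_apply_eq_zero_of_notMem_tsupport hy', mul_zero, mul_zero]
    have hc0 : ce x * φ x = c x * φ x := by
      by_cases hx : x ∈ closedBall x₀ (ε / 4)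
      · rw [hce_eq x hx]
      · have hx' : x ∉ tsupport φ := fun h ↦ hx (hUcb (hφU h))
        rw [image_eq_zero_of_notMem_tsupport hx', mul_zero, mul_zero]
    simp only [hfun, hc0]
  -- the image of `u dμ` under the operator is the smooth function `G` on `U`
  have himg : Distribution.ImageIsSmoothOn uD (smoothDiffOpTranspose (fun k : κ ↦ fun _ : E ↦ b k)
      (divFormWords κ) (divFormCoeff b ae ce)) μ U := by
    refine ⟨G, hG.mono hUΩ, fun φ ψ hφU hψ ↦ ?_⟩
    rw [huD ψ]
    calc ∫ x, ψ x * u x ∂μ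
        = ∫ x, u x * ((∑ i, ∑ j, fderiv ℝ (fun y ↦ a i j y * fderiv ℝ φ y (b i)) x (b j)) -
            c x * φ x) ∂μ := by
          refine integral_congr_ae (Eventually.of_forall fun x ↦ ?_)
          dsimp only
          rw [hψ, hLe φ φ.contDiff hφU x, mul_comm]
      _ = ∫ x, G x * φ x ∂μ := hweak φ φ.contDiff φ.hasCompactSupport (hφU.trans hUΩ)
  obtain ⟨w, hw, hwint⟩ := hhyp uD U hUo Subset.rfl himg
  refine ⟨U, hUo, hx₀U, hUΩ, w, hw, ?_⟩
  -- `u = w` a.e. on `U` by the fundamental lemma of the calculus of variations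
  have hwU : LocallyIntegrableOn w U μ := hw.continuousOn.locallyIntegrableOn hUo.measurableSet
  have hz := hUo.ae_eq_zero_of_integral_contDiff_smul_eq_zero (μ := μ)
    (f := fun x ↦ u x - w x) (huU.sub hwU) (fun g hg hgc hgU ↦ by
      let φg : 𝓓(UO, ℝ) := ⟨g, hg, hgc, hgU⟩
      have h1 : ∫ x, g x * u x ∂μ = ∫ x, w x * g x ∂μ := by
        have := hwint φg hgU
        rw [huD] at this
        exact this
      have hi1 : Integrable (fun x ↦ g x * u x) μ :=
        TestFunction.integrable_bilin (ContinuousLinearMap.mul ℝ ℝ) huU φg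
      have hi2 : Integrable (fun x ↦ g x * w x) μ :=
        TestFunction.integrable_bilin (ContinuousLinearMap.mul ℝ ℝ) hwU φg
      simp only [smul_eq_mul, mul_sub]
      rw [integral_sub hi1 hi2, h1, sub_eq_zero]
      exact integral_congr_ae (Eventually.of_forall fun x ↦ mul_comm _ _))
  filter_upwards [hz] with x hx hxU
  exact sub_eq_zero.1 (hx hxU)

end Regularity

end Literature.Analysis.Distribution
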